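import Summits.CriticalPhenomena.CardyFormulaZ2.Theorems.CardyComplexConeParafermionToSLESixFamiliesFlipDefs
import Summits.CriticalPhenomena.CardyFormulaZ2.Theorems.CardyComplexConeParafermionToSLESixFamiliesFlipAllDomainsOfDiag
import Summits.CriticalPhenomena.CardyFormulaZ2.Theorems.CardyComplexConeParafermionToSLESixFamiliesIicRectilinear
import HarnessLib

/-!
# Junk audit of the diagonal touch law of line `flip-involution-return-law` (stub `stub_touchLawDiag`)

Crux `ParafermionToSLESixFamilies` (stmt-CriticalPhenomena-11389), line `flip-involution-return-law`,
vocabulary `Theorems/CardyComplexConeParafermionToSLESixFamiliesFlipDefs.lean`. The registered stub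
`stub_touchLawDiag : WeakHolFamilies → PrecompactFamilies → StaggerSummedVanishing → MesoEnvelope →
DiagHalfPlaneOneArmLower → ∀ D, IsDiagRectilinear D → TouchLawPosDiag D` is the line's research stub
(identification I + non-degeneracy N); this file does NOT prove it. It is the diagonal twin of
`…IicTouchAudit.lean` (audit of the axis law `TouchLawPos`) and certifies, sorry-free, that the conclusion
`TouchLawPosDiag D` is neither vacuous nor junk:

* §1–§2 (orientation, density clause). Diagonal directions are unit vectors (`norm_eq_one_of_isDiagDir`), so
  for a diagonal window `(m, η, a, b)` the frame `(tCoord, nCoord)` of `…IicDefs` is a genuine rotated box: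
  `t ↦ m + t·(iη)` has coordinates `(t, 0)`, and moving by `s·η` — the INWARD normal, since `carrier_iff`
  reads `z ∈ D ↔ 0 < nCoord` — gives `(t, s)` (`coords_diagWindowPoint_add`); window points lie on the free
  arc, off the marks, in the closure of the carrier, so `𝓝[D.carrier] y ≠ ⊥`
  (`nhdsWithin_carrier_neBot_of_diagWindow`) and the covariant density of `HasTouchDensityAt` is UNIQUELY
  determined at every diagonal window point (`HasTouchDensityAt.unique_diag`), as in the axis case.
* §3 (non-vacuity of ALL hypothesis classes at once; registered glue
  `exists_isDiagRectilinear_isFamily_isDiagFreeWindow`). The tilted marked square `(1+i)·((-1,1)²; ∓i)`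
  (vertices `±2, ±2i`, marks `1 - i`, `-1 + i`) is an all-diagonal polygon (`isDiagRectilinear_map_tilt`,
  landed in `…FlipAllDomainsOfDiag.lean`), carries an admissible discretisation family (every Dobrushin domain
  does: `exists_isFamily`, ibid., from the PROVED construction item `DiscretisationFamilyExists_proof`), AND
  has the flat diagonal free window `m = -1 - i`, `η = (1+i)/√2`, `a = b = 1` on its free side
  `[-2, -2i] ⊆ D.arc 1` (`isDiagFreeWindow_of_tiltedSquare`: the window class `IsDiagFreeWindow` is inhabited
  with the inward-normal convention). So the stub is a genuine (family, window) instance, not vacuously true.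

Paper part (point (c), for the lead): along ANY admissible family of an all-diagonal polygon the discrete
boundary along a diagonal window is, for small mesh, the double staircase `{i+j ∈ {k₀, k₀+1}}` ⊆ `zdArcB`,
and the touch sites in the window are exactly the two sublattices `{i+j = k₀+2}`, `{i+j = k₀+3}` (`2` per
period `√2·δ`), each with `touchProb > 0`: `touchFunctional` never vanishes identically near a diagonal free
side; the truth of `TouchLawPosDiag` is the research content (trace tightness + identification).
-/


noncomputable section

open scoped Topology NNReal ENNReal BigOperators
open Filter Set MeasureTheory Metric
open Literature.Probability Literature.Probability.LatticeModels Literature.Probability.Percolation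
open Literature.Probability.RandomPlanarGeometry
open Summit.CriticalPhenomena.CardyFormulaZ2.Cruxes.ParafermionToSLESixFamilies.IicTraceFluxPairing

namespace Summit.CriticalPhenomena.CardyFormulaZ2.Cruxes.ParafermionToSLESixFamilies.FlipInvolutionReturnLaw

/-! ### §1 Diagonal directions are unit vectors -/

/-- A diagonal direction has `normSq = 1`. -/
theorem normSq_eq_one_of_isDiagDir {η : ℂ} (hη : IsDiagDir η) : Complex.normSq η = 1 := by
  have h2 : Complex.normSq (Real.sqrt 2 : ℂ) = 2 := by
    rw [Complex.normSq_ofReal, Real.mul_self_sqrt (by norm_num : (0:ℝ) ≤ 2)]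
  rcases hη with rfl | rfl | rfl | rfl <;>
    · rw [Complex.normSq_div, h2, Complex.normSq_apply]
      simp

/-- Diagonal directions are unit vectors. -/
theorem norm_eq_one_of_isDiagDir {η : ℂ} (hη : IsDiagDir η) : ‖η‖ = 1 := by
  have h := normSq_eq_one_of_isDiagDir hη
  rw [Complex.normSq_eq_norm_sq] at h
  exact (pow_eq_one_iff_of_nonneg (norm_nonneg η) two_ne_zero).1 h

/-- For a diagonal direction, `η · conj η = 1`. -/
theorem mul_conj_eq_one_of_isDiagDir {η : ℂ} (hη : IsDiagDir η) : η * (starRingEnd ℂ) η = 1 := by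
  rw [Complex.mul_conj, normSq_eq_one_of_isDiagDir hη, Complex.ofReal_one]

/-! ### §2 Window bookkeeping for diagonal windows: where the limit measure of `TouchLawPosDiag` lives -/

section Window

/-- The boundary parametrisation `t ↦ m + t·(iη)` of a diagonal window has tangential coordinate `t`. -/
theorem tCoord_diagWindowPoint {η : ℂ} (hη : IsDiagDir η) (m : ℂ) (t : ℝ) :
    tCoord m η (m + (t : ℂ) * (Complex.I * η)) = t := by
  have hu := mul_conj_eq_one_of_isDiagDir hη
  unfold tCoord
  have h : (m + (t : ℂ) * (Complex.I * η) - m) * (starRingEnd ℂ) (Complex.I * η) = (t : ℂ) := by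
    rw [add_sub_cancel_left, map_mul, Complex.conj_I]
    calc (t : ℂ) * (Complex.I * η) * (-Complex.I * (starRingEnd ℂ) η)
        = (t : ℂ) * (η * (starRingEnd ℂ) η) * (Complex.I * -Complex.I) := by ring
      _ = (t : ℂ) := by rw [hu]; simp
  rw [h, Complex.ofReal_re]

/-- The boundary parametrisation of a diagonal window has normal coordinate `0`. -/
theorem nCoord_diagWindowPoint {η : ℂ} (hη : IsDiagDir η) (m : ℂ) (t : ℝ) :
    nCoord m η (m + (t : ℂ) * (Complex.I * η)) = 0 := by
  have hu := mul_conj_eq_one_of_isDiagDir hη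
  unfold nCoord
  have h : (m + (t : ℂ) * (Complex.I * η) - m) * (starRingEnd ℂ) η = (t : ℂ) * Complex.I := by
    rw [add_sub_cancel_left]
    calc (t : ℂ) * (Complex.I * η) * (starRingEnd ℂ) η
        = (t : ℂ) * Complex.I * (η * (starRingEnd ℂ) η) := by ring
      _ = (t : ℂ) * Complex.I := by rw [hu, mul_one]
  rw [h]; simp

/-- Moving from the window point `m + t·(iη)` by `s·η` along the INWARD normal of a diagonal window:
tangential coordinate `t`, normal coordinate `s` (so `0 < nCoord` is the inner side, as `carrier_iff` wants). -/
theorem coords_diagWindowPoint_add {η : ℂ} (hη : IsDiagDir η) (m : ℂ) (t s : ℝ) :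
    tCoord m η (m + (t : ℂ) * (Complex.I * η) + (s : ℂ) * η) = t ∧
      nCoord m η (m + (t : ℂ) * (Complex.I * η) + (s : ℂ) * η) = s := by
  have hu := mul_conj_eq_one_of_isDiagDir hη
  constructor
  · unfold tCoord
    have h : (m + (t : ℂ) * (Complex.I * η) + (s : ℂ) * η - m) * (starRingEnd ℂ) (Complex.I * η) =
        (t : ℂ) - (s : ℂ) * Complex.I := by
      rw [map_mul, Complex.conj_I]
      calc (m + (t : ℂ) * (Complex.I * η) + (s : ℂ) * η - m) * (-Complex.I * (starRingEnd ℂ) η)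
          = ((t : ℂ) * (Complex.I * -Complex.I) - (s : ℂ) * Complex.I) * (η * (starRingEnd ℂ) η) := by ring
        _ = (t : ℂ) - (s : ℂ) * Complex.I := by rw [hu]; simp
    rw [h]; simp
  · unfold nCoord
    have h : (m + (t : ℂ) * (Complex.I * η) + (s : ℂ) * η - m) * (starRingEnd ℂ) η =
        (t : ℂ) * Complex.I + (s : ℂ) := by
      calc (m + (t : ℂ) * (Complex.I * η) + (s : ℂ) * η - m) * (starRingEnd ℂ) η
          = ((t : ℂ) * Complex.I + (s : ℂ)) * (η * (starRingEnd ℂ) η) := by ring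
        _ = (t : ℂ) * Complex.I + (s : ℂ) := by rw [hu, mul_one]
    rw [h]; simp

variable {D : DobrushinDomain} {m η : ℂ} {a b : ℝ}

/-- Diagonal window points are boundary points: NOT in the (open) carrier (they have `nCoord = 0`, and
`carrier_iff` puts the carrier at `0 < nCoord`). -/
theorem diagWindowPoint_not_mem_carrier (hW : IsDiagFreeWindow D m η a b) {t : ℝ} (ht : |t| < a) :
    m + (t : ℂ) * (Complex.I * η) ∉ D.carrier := by
  intro hmem
  have h1 := tCoord_diagWindowPoint hW.diag m t
  have h2 := nCoord_diagWindowPoint hW.diag m t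
  have := (hW.carrier_iff (m + (t : ℂ) * (Complex.I * η)) (by rw [h1]; exact ht)
    (by rw [h2, abs_zero]; exact hW.b_pos)).1 hmem
  rw [h2] at this
  exact lt_irrefl _ this

/-- Diagonal window points lie on the free arc `D.arc 1` and are not the marked points (so, on paper, the
inverse `ψ` of a chordal uniformizer extends across the flat side with `ψ ≠ 0, ∞` there and the density
`|ψ′/ψ|^{1/3}` of `HasTouchDensityAt` is finite and positive). -/
theorem diagWindowPoint_mem_arc_and_ne_marks (hW : IsDiagFreeWindow D m η a b) {t : ℝ} (ht : |t| < a) :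
    m + (t : ℂ) * (Complex.I * η) ∈ D.arc 1 ∧
      m + (t : ℂ) * (Complex.I * η) ≠ D.pt 0 ∧ m + (t : ℂ) * (Complex.I * η) ≠ D.pt 1 :=
  ⟨hW.subset_arc _ (by rw [tCoord_diagWindowPoint hW.diag]; exact ht) (nCoord_diagWindowPoint hW.diag m t),
    hW.marks _ (by rw [tCoord_diagWindowPoint hW.diag]; exact ht)
      (by rw [nCoord_diagWindowPoint hW.diag, abs_zero]; exact hW.b_pos)⟩

/-- Points just inside a diagonal window (normal coordinate `s ∈ (0, b)`) belong to the carrier. -/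
theorem diagWindowPoint_add_mem_carrier (hW : IsDiagFreeWindow D m η a b) {t s : ℝ} (ht : |t| < a)
    (hs : 0 < s) (hsb : s < b) : m + (t : ℂ) * (Complex.I * η) + (s : ℂ) * η ∈ D.carrier := by
  obtain ⟨h1, h2⟩ := coords_diagWindowPoint_add hW.diag m t s
  refine (hW.carrier_iff _ (by rw [h1]; exact ht) (by rw [h2, abs_of_pos hs]; exact hsb)).2 ?_
  rw [h2]; exact hs

/-- **Diagonal window points lie in the closure of the carrier** (approach along the inward normal `η`). -/
theorem diagWindowPoint_mem_closure_carrier (hW : IsDiagFreeWindow D m η a b) {t : ℝ} (ht : |t| < a) :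
    m + (t : ℂ) * (Complex.I * η) ∈ closure D.carrier := by
  rw [Metric.mem_closure_iff]
  intro ε hε
  set s := min (ε / 2) (b / 2) with hs
  have hs0 : 0 < s := lt_min (half_pos hε) (half_pos hW.b_pos)
  have hsb : s < b := (min_le_right _ _).trans_lt (half_lt_self hW.b_pos)
  refine ⟨m + (t : ℂ) * (Complex.I * η) + (s : ℂ) * η, diagWindowPoint_add_mem_carrier hW ht hs0 hsb, ?_⟩
  rw [dist_eq_norm]
  have : m + (t : ℂ) * (Complex.I * η) - (m + (t : ℂ) * (Complex.I * η) + (s : ℂ) * η) =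
      -((s : ℂ) * η) := by
    ring
  rw [this, norm_neg, norm_mul, norm_eq_one_of_isDiagDir hW.diag, mul_one, Complex.norm_real,
    Real.norm_eq_abs, abs_of_pos hs0]
  exact (min_le_left _ _).trans_lt (half_lt_self hε)

/-- Hence `𝓝[D.carrier] y` is non-trivial at every diagonal window point `y`: the limit in
`HasTouchDensityAt` is a genuine constraint, not a `Tendsto` along `⊥`. -/
theorem nhdsWithin_carrier_neBot_of_diagWindow (hW : IsDiagFreeWindow D m η a b) {t : ℝ} (ht : |t| < a) :
    (𝓝[D.carrier] (m + (t : ℂ) * (Complex.I * η))).NeBot :=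
  mem_closure_iff_nhdsWithin_neBot.1 (diagWindowPoint_mem_closure_carrier hW ht)

/-- **The covariant touch density at a diagonal window point is uniquely determined** (given a chordal
uniformizer `φ`): two values `ρ, ρ'` both satisfying `HasTouchDensityAt D y ·` coincide — so the density
function of `TouchLawPosDiag` is unique on the window and the limit `c · ρ · dt` is determined up to `c`. -/
theorem HasTouchDensityAt.unique_diag (hW : IsDiagFreeWindow D m η a b) {t : ℝ} (ht : |t| < a)
    (φ : ConformalEquiv UpperHalfPlane.upperHalfPlaneSet D.carrier) (hφ : D.IsChordalUniformizing φ)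
    {ρ ρ' : ℝ} (h : HasTouchDensityAt D (m + (t : ℂ) * (Complex.I * η)) ρ)
    (h' : HasTouchDensityAt D (m + (t : ℂ) * (Complex.I * η)) ρ') : ρ = ρ' := by
  haveI := nhdsWithin_carrier_neBot_of_diagWindow hW ht
  exact tendsto_nhds_unique (h φ hφ) (h' φ hφ)

/-- Consequently the density FUNCTION of `TouchLawPosDiag` is unique on a diagonal window: two admissible
choices agree at every window point (the limit `c · ρ · dt` is determined up to the constant `c`). -/
theorem touchDensity_eqOn_diagWindow (hW : IsDiagFreeWindow D m η a b)
    (φ : ConformalEquiv UpperHalfPlane.upperHalfPlaneSet D.carrier) (hφ : D.IsChordalUniformizing φ)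
    {ρ ρ' : ℂ → ℝ} (h : ∀ y : ℂ, |tCoord m η y| < a → nCoord m η y = 0 → HasTouchDensityAt D y (ρ y))
    (h' : ∀ y : ℂ, |tCoord m η y| < a → nCoord m η y = 0 → HasTouchDensityAt D y (ρ' y)) :
    ∀ t : ℝ, |t| < a → ρ (m + (t : ℂ) * (Complex.I * η)) = ρ' (m + (t : ℂ) * (Complex.I * η)) := by
  intro t ht
  have h1 := tCoord_diagWindowPoint hW.diag m t
  have h2 := nCoord_diagWindowPoint hW.diag m t
  exact HasTouchDensityAt.unique_diag hW ht φ hφ (h _ (by rw [h1]; exact ht) h2)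
    (h' _ (by rw [h1]; exact ht) h2)

end Window

/-! ### §3 Non-vacuity: an all-diagonal polygon with an admissible family AND a diagonal free window
(no definition introduced: lemmas for any domain with the tilted square's carrier / marks / free side). -/

section TiltedSquare

variable {D : DobrushinDomain}

/-- Membership in the tilted square `(1+i)·(-1,1)²`, in coordinates: `|re + im| < 2` and `|im - re| < 2`. -/
theorem mem_carrier_iff_of_tiltedSquare (hc : D.carrier = (fun z : ℂ => (1 + Complex.I) * z) '' symRect 1 1)
    {u : ℂ} : u ∈ D.carrier ↔
      (-2 < u.re + u.im ∧ u.re + u.im < 2) ∧ (-2 < u.im - u.re ∧ u.im - u.re < 2) := by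
  rw [hc]
  constructor
  · rintro ⟨z, hz, rfl⟩
    rw [mem_symRect] at hz
    obtain ⟨⟨h1, h2⟩, h3, h4⟩ := hz
    simp only [Complex.mul_re, Complex.mul_im, Complex.add_re, Complex.one_re, Complex.I_re, Complex.add_im,
      Complex.one_im, Complex.I_im]
    refine ⟨⟨by linarith, by linarith⟩, by linarith, by linarith⟩
  · rintro ⟨⟨h1, h2⟩, h3, h4⟩
    refine ⟨⟨(u.re + u.im) / 2, (u.im - u.re) / 2⟩, ?_, ?_⟩
    · rw [mem_symRect]
      refine ⟨⟨by linarith, by linarith⟩, by linarith, by linarith⟩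
    · apply Complex.ext <;> simp [Complex.mul_re, Complex.mul_im] <;> ring

/-- The conjugate of the diagonal direction `(1+i)/√2` is `(1-i)/√2`. -/
theorem conj_diagDir_one :
    (starRingEnd ℂ) ((1 + Complex.I) / (Real.sqrt 2 : ℂ)) = (1 - Complex.I) / (Real.sqrt 2 : ℂ) := by
  rw [map_div₀, Complex.conj_ofReal, map_add, map_one, Complex.conj_I]
  ring

/-- Normal coordinate of the model window (base `-1 - i`, inward normal `(1+i)/√2`): `(re + im + 2)/√2`. -/
theorem nCoord_tiltedSquareWindow (z : ℂ) :
    nCoord ⟨-1, -1⟩ ((1 + Complex.I) / (Real.sqrt 2 : ℂ)) z = (z.re + z.im + 2) / Real.sqrt 2 := by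
  unfold nCoord
  rw [conj_diagDir_one, ← mul_div_assoc, Complex.div_ofReal_re]
  congr 1
  simp [Complex.mul_re]
  ring

/-- Tangential coordinate of the model window: `(im - re)/√2`. -/
theorem tCoord_tiltedSquareWindow (z : ℂ) :
    tCoord ⟨-1, -1⟩ ((1 + Complex.I) / (Real.sqrt 2 : ℂ)) z = (z.im - z.re) / Real.sqrt 2 := by
  unfold tCoord
  rw [map_mul, Complex.conj_I, conj_diagDir_one]
  have h : (z - ⟨-1, -1⟩) * (-Complex.I * ((1 - Complex.I) / (Real.sqrt 2 : ℂ))) =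
      (z - ⟨-1, -1⟩) * (-Complex.I * (1 - Complex.I)) / (Real.sqrt 2 : ℂ) := by ring
  rw [h, Complex.div_ofReal_re]
  congr 1
  simp [Complex.mul_re, Complex.mul_im]

/-- **The model diagonal free window** of a Dobrushin domain with the tilted square's carrier, marks `1 - i`,
`-1 + i`, and free arc containing the open side `(-2, -2i)`: base point `m = -1 - i` (the side's midpoint),
inward diagonal normal `η = (1+i)/√2`, half-widths `a = b = 1`. -/
theorem isDiagFreeWindow_of_tiltedSquare
    (hc : D.carrier = (fun z : ℂ => (1 + Complex.I) * z) '' symRect 1 1) (h0 : D.pt 0 = ⟨1, -1⟩)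
    (h1 : D.pt 1 = ⟨-1, 1⟩) (harc : ∀ z : ℂ, z.re + z.im = -2 → |z.im - z.re| < 2 → z ∈ D.arc 1) :
    IsDiagFreeWindow D ⟨-1, -1⟩ ((1 + Complex.I) / (Real.sqrt 2 : ℂ)) 1 1 := by
  have h2 : 0 < Real.sqrt 2 := Real.sqrt_pos.2 (by norm_num)
  have hlt : Real.sqrt 2 < 2 := (Real.sqrt_lt' (by norm_num : (0:ℝ) < 2)).2 (by norm_num)
  have key : ∀ x : ℝ, |x / Real.sqrt 2| < 1 → |x| < Real.sqrt 2 := fun x hx => by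
    rwa [abs_div, abs_of_pos h2, div_lt_one h2] at hx
  refine ⟨Or.inl rfl, one_pos, one_pos, fun z ht hn => ?_, fun z ht hn => ?_, fun z ht hn => ?_⟩
  · rw [tCoord_tiltedSquareWindow] at ht
    rw [nCoord_tiltedSquareWindow] at hn ⊢
    have ht' := abs_lt.1 (key _ ht)
    have hn' := abs_lt.1 (key _ hn)
    rw [mem_carrier_iff_of_tiltedSquare hc, div_pos_iff_of_pos_right h2]
    constructor
    · rintro ⟨⟨h, -⟩, -⟩; linarith
    · intro h; exact ⟨⟨by linarith, by linarith⟩, by linarith, by linarith⟩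
  · rw [tCoord_tiltedSquareWindow] at ht
    rw [nCoord_tiltedSquareWindow, div_eq_zero_iff] at hn
    have hs : z.re + z.im = -2 := by
      rcases hn with h | h
      · linarith
      · exact absurd h h2.ne'
    exact harc z hs ((key _ ht).trans hlt)
  · rw [nCoord_tiltedSquareWindow] at hn
    have hn' := (abs_lt.1 (key _ hn)).2
    rw [h0, h1]
    constructor
    · intro h
      have hre : z.re = 1 := by rw [h]
      have him : z.im = -1 := by rw [h]
      linarith
    · intro h
      have hre : z.re = -1 := by rw [h]
      have him : z.im = 1 := by rw [h]
      linarith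

end TiltedSquare

/-- The left side of `(-1,1)²`: parameters `(3 + θ)/4`, `θ ∈ [0, 1]`, run from `(-1, 1)` to `(-1, -1)`. -/
theorem rectDomain_one_one_boundary_left {θ : ℝ} (hθ : θ ∈ Icc (0 : ℝ) 1) :
    (rectDomain 1 1 one_pos one_pos).boundary ((3 + θ) / 4) = ⟨-1, 1 - 2 * θ⟩ := by
  have h := polygonLoop_apply_div (l := rectVerts (1 : ℝ) 1) (k := 3) (by simp) hθ
  simp only [Nat.cast_ofNat, length_rectVerts, Nat.reduceAdd, Nat.reduceMod] at h
  change polygonLoop (rectVerts (1 : ℝ) 1) ((3 + θ) / 4) = _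
  rw [h]
  simp only [rectVerts, List.getElem_cons_zero, List.getElem_cons_succ, AffineMap.lineMap_apply_module']
  apply Complex.ext
  · simp
  · simp; ring

/-- Points of the open side `(-2, -2i)` of the tilted marked square (`re + im = -2`, `|im - re| < 2`) lie on
its free arc `arc 1` (the tilt of the parameter interval `[5/8, 9/8] ⊇ [3/4, 1]` = left side of the square). -/
theorem mem_arc_one_tiltedSquare {z : ℂ} (hs : z.re + z.im = -2) (hd : |z.im - z.re| < 2) :
    z ∈ ((⟨rectDomain 1 1 one_pos one_pos, ![1 / 8, 5 / 8], squareMarks_strictMono, squareMarks_mem⟩ :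
      DobrushinDomain).map (Homeomorph.mulLeft₀ (1 + Complex.I) one_add_I_ne_zero)).arc 1 := by
  rw [MarkedDomain.arc_map, Homeomorph.coe_mulLeft₀]
  obtain ⟨hd1, hd2⟩ := abs_lt.1 hd
  set θ : ℝ := (1 - (z.im - z.re) / 2) / 2 with hθ
  have hθm : θ ∈ Icc (0 : ℝ) 1 := ⟨by rw [hθ]; linarith, by rw [hθ]; linarith⟩
  refine ⟨⟨-1, (z.im - z.re) / 2⟩, ⟨(3 + θ) / 4, ⟨?_, ?_⟩, ?_⟩, ?_⟩
  · change (5 : ℝ) / 8 ≤ _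
    linarith [hθm.1]
  · have hn : MarkedDomain.nextMark (⟨rectDomain 1 1 one_pos one_pos, ![1 / 8, 5 / 8],
        squareMarks_strictMono, squareMarks_mem⟩ : DobrushinDomain) 1 = 1 / 8 + 1 := by
      simp [MarkedDomain.nextMark]
    change _ ≤ MarkedDomain.nextMark _ 1
    rw [hn]
    linarith [hθm.2]
  · change (rectDomain 1 1 one_pos one_pos).boundary ((3 + θ) / 4) = _
    rw [rectDomain_one_one_boundary_left hθm]
    apply Complex.ext
    · simp
    · simp only [hθ]; ring
  · apply Complex.ext
    · simp; linarith
    · simp; linarith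

/-- **Registered glue: every hypothesis class of `stub_touchLawDiag`'s conclusion is inhabited at once.**
There is an all-diagonal Dobrushin polygon carrying an admissible discretisation family AND a flat diagonal
free window — the tilted marked square `(1+i)·((-1,1)²; ∓i)` with the window at the midpoint `-1 - i` of its
free side `[-2, -2i]`. So `∀ D, IsDiagRectilinear D → TouchLawPosDiag D` is a genuine (family, window)
instance of the touch-intensity law, not a vacuous implication. -/
theorem exists_isDiagRectilinear_isFamily_isDiagFreeWindow : ∃ (D : DobrushinDomain) (Λ : ℝ → DiscreteDobrushin) (m η : ℂ) (a b : ℝ), IsDiagRectilinear D ∧ IsFamily D Λ ∧ IsDiagFreeWindow D m η a b := by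
  set D : DobrushinDomain := (⟨rectDomain 1 1 one_pos one_pos, ![1 / 8, 5 / 8], squareMarks_strictMono,
    squareMarks_mem⟩ : DobrushinDomain).map (Homeomorph.mulLeft₀ (1 + Complex.I) one_add_I_ne_zero) with hD
  have hc : D.carrier = (fun z : ℂ => (1 + Complex.I) * z) '' symRect 1 1 := by
    rw [hD, MarkedDomain.carrier_map, Homeomorph.coe_mulLeft₀]
    rfl
  have h0 : D.pt 0 = ⟨1, -1⟩ := by
    rw [hD, MarkedDomain.pt_map, pt_zero_of_square _ rfl rfl, Homeomorph.coe_mulLeft₀]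
    apply Complex.ext <;> simp
  have h1 : D.pt 1 = ⟨-1, 1⟩ := by
    rw [hD, MarkedDomain.pt_map, pt_one_of_square _ rfl rfl, Homeomorph.coe_mulLeft₀]
    apply Complex.ext <;> simp
  obtain ⟨Λ, hΛ⟩ := exists_isFamily D
  refine ⟨D, Λ, _, _, _, _, ?_, hΛ, isDiagFreeWindow_of_tiltedSquare hc h0 h1 fun z hs hd => ?_⟩
  · rw [hD]
    exact isDiagRectilinear_map_tilt _ (isRectilinear_of_carrier_eq_symRect _ one_pos one_pos rfl)
  · rw [hD]
    exact mem_arc_one_tiltedSquare hs hd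

end Summit.CriticalPhenomena.CardyFormulaZ2.Cruxes.ParafermionToSLESixFamilies.FlipInvolutionReturnLaw

end
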